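import Mathlib
import Summits.Ventures.PercRepro2.TypedSeries

/-!
# Marked series vertices of degree two: the graph lemmas (blind cell PercRepro2, night-3 g13,
2026-08-27; `proofs/NIGHT3-CERT.md` §22)

At a vertex `w` with exactly two edges `e = {u, w}`, `f = {w, v}` (its other edges closed):
`conn_series_open` — with both edges open, the connections among the other vertices are those of
the closed configuration with the clusters of `u` and `v` joined; `conn_mid_iff` — `w` is joined to
`s ≠ w` iff one of its edges is open and leads into the cluster of `s`; `conn_off_mid` — the general
form for an arbitrary pair of bits (through `conn_series` of `TypedSeries.lean`).  Configuration
level, no marks involved.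
-/

namespace Summit.Ventures.PercRepro2

open UnionCluster

namespace CovForm

namespace MarkedSeries

open TypedRed

/-! ## Graph lemmas at a vertex of degree two -/

section Graph

variable {V : Type*} {E : Type*} [DecidableEq E]

/-- With both edges at `w` closed, `w` is isolated. -/
lemma conn_isolated_of_closed {ends : E → Sym2 V} {e f : E} (hef : e ≠ f) {u w : V}
    (he : ends e = s(u, w)) (x : Config E)
    (hother : ∀ e', e' ≠ e → e' ≠ f → w ∈ ends e' → x e' = false) {y : V}
    (h : Conn ends (Function.update (Function.update x e false) f false) w y) : y = w := by
  have he' : ends e = s(w, u) := by rw [he, Sym2.eq_swap]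
  refine conn_closed_at_eq he' (fun e' he'' hw => ?_) ?_ h
  · by_cases hef' : e' = f
    · subst hef'; exact Function.update_self _ _ _
    · rw [Function.update_of_ne hef', Function.update_of_ne he'']; exact hother e' he'' hef' hw
  · rw [Function.update_of_ne hef, Function.update_self]

/-- **Both edges open**: the connections among vertices other than `w` in `x[e ↦ open][f ↦ open]`
are those of the closed configuration `x₀ = x[e ↦ closed][f ↦ closed]` with the clusters of `u`
and `v` joined. -/
lemma conn_series_open {ends : E → Sym2 V} {e f : E} (hef : e ≠ f) {u w v : V}
    (he : ends e = s(u, w)) (hf : ends f = s(w, v)) (x : Config E)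
    (hother : ∀ e', e' ≠ e → e' ≠ f → w ∈ ends e' → x e' = false) {s t : V}
    (hs : s ≠ w) (ht : t ≠ w) :
    Conn ends (Function.update (Function.update x e true) f true) s t ↔
      Conn ends (Function.update (Function.update x e false) f false) s t ∨
        ((Conn ends (Function.update (Function.update x e false) f false) s u ∨
          Conn ends (Function.update (Function.update x e false) f false) s v) ∧
         (Conn ends (Function.update (Function.update x e false) f false) t u ∨
          Conn ends (Function.update (Function.update x e false) f false) t v)) := by
  set x₀ := Function.update (Function.update x e false) f false with hx₀
  set x₁ := Function.update (Function.update x e true) f true with hx₁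
  have hx₁e : x₁ e = true := by rw [hx₁, Function.update_of_ne hef, Function.update_self]
  have hx₁f : x₁ f = true := by rw [hx₁, Function.update_self]
  have hle : x₀ ≤ x₁ := by
    intro g
    by_cases hg : g = f
    · subst hg; rw [hx₀, hx₁, Function.update_self, Function.update_self]; exact Bool.false_le _
    · by_cases hg' : g = e
      · subst hg'
        rw [hx₀, hx₁, Function.update_of_ne hg, Function.update_of_ne hg, Function.update_self,
          Function.update_self]
        exact Bool.false_le _
      · rw [hx₀, hx₁, Function.update_of_ne hg, Function.update_of_ne hg, Function.update_of_ne hg',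
          Function.update_of_ne hg']
  have hiso : ∀ {y : V}, Conn ends x₀ w y → y = w := fun h =>
    conn_isolated_of_closed hef he x hother h
  have hwu : Conn ends x₁ u w := conn_of_openAdj ⟨e, hx₁e, he⟩
  have hwv : Conn ends x₁ w v := conn_of_openAdj ⟨f, hx₁f, hf⟩
  constructor
  · intro h
    let S : Set V := {y | Conn ends x₀ s y ∨ ((Conn ends x₀ s u ∨ Conn ends x₀ s v) ∧
      (y = w ∨ Conn ends x₀ y u ∨ Conn ends x₀ y v))}
    have hS : ∀ y ∈ S, ∀ z, (openGraph ends x₁).Adj y z → z ∈ S := by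
      intro y hy z hyz
      obtain ⟨_, g, hg, hends⟩ := openGraph_adj.1 hyz
      by_cases hge : g = e
      · rw [hge] at hg hends
        rw [he, Sym2.eq_iff] at hends
        rcases hends with ⟨rfl, rfl⟩ | ⟨rfl, rfl⟩
        · -- `y = u`, `z = w`
          have hsuv : Conn ends x₀ s u ∨ Conn ends x₀ s v := by
            rcases hy with hy | ⟨hy, _⟩
            · exact Or.inl hy
            · exact hy
          exact Or.inr ⟨hsuv, Or.inl rfl⟩
        · -- `y = w`, `z = u`
          have hsuv : Conn ends x₀ s u ∨ Conn ends x₀ s v := by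
            rcases hy with hy | ⟨hy, _⟩
            · exact absurd (hiso (conn_symm hy)) hs
            · exact hy
          exact Or.inr ⟨hsuv, Or.inr (Or.inl (conn_refl ends x₀ u))⟩
      · by_cases hgf : g = f
        · rw [hgf] at hg hends
          rw [hf, Sym2.eq_iff] at hends
          rcases hends with ⟨rfl, rfl⟩ | ⟨rfl, rfl⟩
          · -- `y = w`, `z = v`
            have hsuv : Conn ends x₀ s u ∨ Conn ends x₀ s v := by
              rcases hy with hy | ⟨hy, _⟩
              · exact absurd (hiso (conn_symm hy)) hs
              · exact hy
            exact Or.inr ⟨hsuv, Or.inr (Or.inr (conn_refl ends x₀ v))⟩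
          · -- `y = v`, `z = w`
            have hsuv : Conn ends x₀ s u ∨ Conn ends x₀ s v := by
              rcases hy with hy | ⟨hy, _⟩
              · exact Or.inr hy
              · exact hy
            exact Or.inr ⟨hsuv, Or.inl rfl⟩
        · -- another edge: not at `w`, open in `x₀`
          have hg₀ : x₀ g = true := by
            rw [hx₀, Function.update_of_ne hgf, Function.update_of_ne hge]
            rw [hx₁, Function.update_of_ne hgf, Function.update_of_ne hge] at hg
            exact hg
          have hyw : y ≠ w := by
            rintro rfl
            have := hother g hge hgf (by rw [hends]; exact Sym2.mem_mk_left y z)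
            rw [hx₀, Function.update_of_ne hgf, Function.update_of_ne hge, this] at hg₀
            exact absurd hg₀ Bool.false_ne_true
          have hzw : z ≠ w := by
            rintro rfl
            have := hother g hge hgf (by rw [hends]; exact Sym2.mem_mk_right y z)
            rw [hx₀, Function.update_of_ne hgf, Function.update_of_ne hge, this] at hg₀
            exact absurd hg₀ Bool.false_ne_true
          have hyz₀ : Conn ends x₀ y z := conn_of_openAdj ⟨g, hg₀, hends⟩
          rcases hy with hy | ⟨hsuv, hy⟩
          · exact Or.inl (conn_trans hy hyz₀)
          · refine Or.inr ⟨hsuv, ?_⟩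
            rcases hy with hy | hy | hy
            · exact absurd hy hyw
            · exact Or.inr (Or.inl (conn_trans (conn_symm hyz₀) hy))
            · exact Or.inr (Or.inr (conn_trans (conn_symm hyz₀) hy))
    have hmem : t ∈ S := mem_of_conn_of_closed hS (Or.inl (conn_refl ends x₀ s)) h
    rcases hmem with hmem | ⟨hsuv, hmem⟩
    · exact Or.inl hmem
    · rcases hmem with hmem | hmem
      · exact absurd hmem ht
      · exact Or.inr ⟨hsuv, hmem⟩
  · rintro (h | ⟨hsuv, htuv⟩)
    · exact conn_mono hle h
    · have hsw : Conn ends x₁ s w := by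
        rcases hsuv with h | h
        · exact conn_trans (conn_mono hle h) hwu
        · exact conn_trans (conn_mono hle h) (conn_symm hwv)
      have htw : Conn ends x₁ t w := by
        rcases htuv with h | h
        · exact conn_trans (conn_mono hle h) hwu
        · exact conn_trans (conn_mono hle h) (conn_symm hwv)
      exact conn_trans hsw (conn_symm htw)

/-- **The middle vertex**: `w` is connected to `s ≠ w` iff one of its two edges is open and leads
into the cluster of `s`. -/
lemma conn_mid_iff {ends : E → Sym2 V} {e f : E} (hef : e ≠ f) {u w v : V}
    (he : ends e = s(u, w)) (hf : ends f = s(w, v)) (hwu : w ≠ u) (hwv : w ≠ v) (x : Config E)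
    (hother : ∀ e', e' ≠ e → e' ≠ f → w ∈ ends e' → x e' = false) (p a : Bool) {s : V}
    (hs : s ≠ w) :
    Conn ends (Function.update (Function.update x e p) f a) s w ↔
      (p = true ∧ Conn ends (Function.update (Function.update x e p) f a) s u) ∨
      (a = true ∧ Conn ends (Function.update (Function.update x e p) f a) s v) := by
  set x' := Function.update (Function.update x e p) f a with hx'
  have hx'e : x' e = p := by rw [hx', Function.update_of_ne hef, Function.update_self]
  have hx'f : x' f = a := by rw [hx', Function.update_self]
  have huw : p = true → Conn ends x' u w := fun hp => conn_of_openAdj ⟨e, by rw [hx'e]; exact hp, he⟩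
  have hwv' : a = true → Conn ends x' w v := fun ha => conn_of_openAdj ⟨f, by rw [hx'f]; exact ha, hf⟩
  constructor
  · intro h
    let S : Set V := {y | (y ≠ w ∧ Conn ends x' s y) ∨
      (y = w ∧ ((p = true ∧ Conn ends x' s u) ∨ (a = true ∧ Conn ends x' s v)))}
    have hS : ∀ y ∈ S, ∀ z, (openGraph ends x').Adj y z → z ∈ S := by
      intro y hy z hyz
      obtain ⟨_, g, hg, hends⟩ := openGraph_adj.1 hyz
      by_cases hge : g = e
      · rw [hge] at hg hends
        have hp : p = true := by rw [← hx'e]; exact hg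
        rw [he, Sym2.eq_iff] at hends
        rcases hends with ⟨rfl, rfl⟩ | ⟨rfl, rfl⟩
        · -- `y = u`, `z = w`
          rcases hy with ⟨_, hy⟩ | ⟨hy, _⟩
          · exact Or.inr ⟨rfl, Or.inl ⟨hp, hy⟩⟩
          · exact absurd hy.symm hwu
        · -- `y = w`, `z = u`
          rcases hy with ⟨hy, _⟩ | ⟨_, hy⟩
          · exact absurd rfl hy
          · refine Or.inl ⟨hwu.symm, ?_⟩
            rcases hy with ⟨_, hy⟩ | ⟨ha, hy⟩
            · exact hy
            · exact conn_trans (conn_trans hy (conn_symm (hwv' ha))) (conn_symm (huw hp))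
      · by_cases hgf : g = f
        · rw [hgf] at hg hends
          have ha : a = true := by rw [← hx'f]; exact hg
          rw [hf, Sym2.eq_iff] at hends
          rcases hends with ⟨rfl, rfl⟩ | ⟨rfl, rfl⟩
          · -- `y = w`, `z = v`
            rcases hy with ⟨hy, _⟩ | ⟨_, hy⟩
            · exact absurd rfl hy
            · refine Or.inl ⟨hwv.symm, ?_⟩
              rcases hy with ⟨hp, hy⟩ | ⟨_, hy⟩
              · exact conn_trans (conn_trans hy (huw hp)) (hwv' ha)
              · exact hy
          · -- `y = v`, `z = w`
            rcases hy with ⟨_, hy⟩ | ⟨hy, _⟩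
            · exact Or.inr ⟨rfl, Or.inr ⟨ha, hy⟩⟩
            · exact absurd hy.symm hwv
        · have hgx : x' g = x g := by rw [hx', Function.update_of_ne hgf, Function.update_of_ne hge]
          have hyw : y ≠ w := by
            rintro rfl
            have := hother g hge hgf (by rw [hends]; exact Sym2.mem_mk_left y z)
            rw [hgx, this] at hg; exact absurd hg Bool.false_ne_true
          have hzw : z ≠ w := by
            rintro rfl
            have := hother g hge hgf (by rw [hends]; exact Sym2.mem_mk_right y z)
            rw [hgx, this] at hg; exact absurd hg Bool.false_ne_true
          rcases hy with ⟨_, hy⟩ | ⟨hy, _⟩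
          · exact Or.inl ⟨hzw, conn_trans hy (conn_of_openAdj ⟨g, hg, hends⟩)⟩
          · exact absurd hy hyw
    have hmem : w ∈ S := mem_of_conn_of_closed hS (Or.inl ⟨hs, conn_refl ends x' s⟩) h
    rcases hmem with ⟨hmem, _⟩ | ⟨_, hmem⟩
    · exact absurd rfl hmem
    · exact hmem
  · rintro (⟨hp, h⟩ | ⟨ha, h⟩)
    · exact conn_trans h (huw hp)
    · exact conn_trans h (conn_symm (hwv' ha))

/-- **Connections off the middle vertex** for an arbitrary pair of bits: those of the closed
configuration, with the clusters of `u` and `v` joined when both edges are open. -/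
lemma conn_off_mid {ends : E → Sym2 V} {e f : E} (hef : e ≠ f) {u w v : V}
    (he : ends e = s(u, w)) (hf : ends f = s(w, v)) (hwu : w ≠ u) (hwv : w ≠ v) (x : Config E)
    (hother : ∀ e', e' ≠ e → e' ≠ f → w ∈ ends e' → x e' = false) (p a : Bool) {s t : V}
    (hs : s ≠ w) (ht : t ≠ w) :
    Conn ends (Function.update (Function.update x e p) f a) s t ↔
      Conn ends (Function.update (Function.update x e false) f false) s t ∨
        ((p = true ∧ a = true) ∧
         (Conn ends (Function.update (Function.update x e false) f false) s u ∨
          Conn ends (Function.update (Function.update x e false) f false) s v) ∧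
         (Conn ends (Function.update (Function.update x e false) f false) t u ∨
          Conn ends (Function.update (Function.update x e false) f false) t v)) := by
  have hser := conn_series hef he hf hwu hwv x hother p a hs ht
  have hcomm : ∀ (c d : Bool), Function.update (Function.update x f c) e d =
      Function.update (Function.update x e d) f c := fun c d => Function.update_comm (Ne.symm hef) c d x
  -- with `e` closed, the state of `f` is irrelevant off `w`
  have hii : Conn ends (Function.update (Function.update x e false) f true) s t ↔
      Conn ends (Function.update (Function.update x e false) f false) s t := by
    refine conn_update_closed_at_iff hf hwv (fun e' he'' hw => ?_) true hs ht
    by_cases hee' : e' = e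
    · subst hee'; exact Function.update_self _ _ _
    · rw [Function.update_of_ne hee']; exact hother e' hee' he'' hw
  cases p <;> cases a
  · simp only [Bool.and_false, Bool.false_eq_true, false_and, or_false] at hser ⊢
  · simp only [Bool.false_and, Bool.false_eq_true, false_and, or_false] at hser ⊢
    rw [hser, hcomm, hii]
  · simp only [Bool.and_false, Bool.false_eq_true, and_false, false_and, or_false] at hser ⊢
    rw [hser, hcomm, hii]
  · simp only [true_and]
    rw [hser, hcomm]
    exact conn_series_open hef he hf x hother hs ht

end Graph

end MarkedSeries

end CovForm

end Summit.Ventures.PercRepro2
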